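/-
Copyright: width seat `ym-line-sll-p2` (prover-ym-line-sll-p2-g2-0), route `SoftLoopLongLag`, crux T′ `ColdBoxSoftLoopLagFloor`
(stmt-QuantumFields-24180), line `birth`, registered stub E1a `stub_innerFlatLagFloorG`, brick 5.
-/
import Summits.QuantumFields.YangMills.Theorems.SoftLoopLongLagInnerFlatLoopChart
import Summits.QuantumFields.YangMills.Theorems.SoftLoopLongLagInnerFlatLoopGaussSide
import Summits.QuantumFields.YangMills.Theorems.SoftLoopLongLagDirichletLoopInductance
import Summits.QuantumFields.YangMills.Theorems.SoftLoopLongLagLoopKernelMeanDatumCore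
import Summits.QuantumFields.YangMills.Theorems.ColdBoxAllGroupsBoxFloorAllGroupsCoreG

/-!
# Route `SoftLoopLongLag`, crux T′, stub E1a, brick E1a-5 «LoopCore»: the one-scale expansion ASSEMBLED at fixed `β` for the
# cube-smeared soft LOOP observable (deterministic core, every compact group presented in `U(N)`)

Loop counterpart of the sibling brick `ColdBoxAllGroupsBoxFloorAllGroupsCoreG` (`abs_boxPlaqCov_sub_dirCircSqCov_le_coreG`).  Fix a finite
set `C` of base points, two translations `u, v ∈ ℤ⁴` and a side `R`; the two observables are the `β`-scaled loop-cost sums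
`f(U) = Σ_{x∈C} β·(N − Re tr ρ(hol_{rectWalk (x+u) 1 2 R R} U))`, `g` likewise with `v`, and their Gaussian surrogates under
`gaussD H D` are `Q₁(t) = Σ_{x∈C} ½ Σ_i (Σ_{p∈rectSurface (x+u) R R} dirCirc H p (t_i))²`, `Q₂` likewise (bricks E1a-2/4).  Given the
representation `hrep` of the conditioned cold-wall box state as a tilted conditioned `gaussD` (the sibling's landed B4'
`integral_cond_boxState_eq_integral_tilted_G'`, consumed as a hypothesis exactly as in CoreG) and the window hypotheses of CoreG plus
the loop-size condition `4R·m ≤ 1/4`: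

**`abs_loopCov_cond_sub_gauss_le_coreG`**:
`|Cov_{boxState[|coldGoodSetG]}(f, g) − (D/2)·Σ_{x,y∈C} M_D(x+u, y+v)²| ≤ 3M²(e^{2w}−1) + 6M²p + 2τ(M+K) + √p(2MK + 3K² + K²)`,
`M_D(x,y) = Σ_{p∈rectSurface x R R} Σ_{q∈rectSurface y R R} boxDirProjKernel H p q` (written out), `M = #C·β((4Rm)²/2 + 9(4Rm)³)`,
`τ = #C·9β(4Rm)³`, `K = D·#C·R⁴`, `w = #Λ'·190βm³ + #(ColdFreeIdx H)·ℓ`.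
Chain: `hrep` for `f, g, fg` (gauge invariant — the tree's `isZdGaugeInvariant_loopCost` —, measurable, nonnegative), the tree's generic bookkeeping `abs_cov_tilted_cond_sub_cov_le` fed by
`abs_tiltWE_le`, `gaussD_real_compl_goodTE_inter_ball_le`, the loop bounds of E1a-4 and the moments / colour identity of E1a-2.
No sorry; no new definition; standard axioms.  HONEST LABEL: rung R2xi-G RECORD label (leaf `WeakCouplingRates.XiPow`, an UPPER bound on
the lattice mass gap); NOT the Clay mass gap; no summit statement is touched.
-/

set_option autoImplicit false

noncomputable section

open MeasureTheory ProbabilityTheory Finset Real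
open Literature.Probability.LatticeModels (Site zdGraph)
open Literature.MathematicalPhysics.QuantumLattice
open Literature.MathematicalPhysics.QuantumFieldTheory.LatticeMaxwell
open Literature.MathematicalPhysics.QuantumFieldTheory.AxialGauge
open Summit.QuantumFields.YangMills.Theorems.WeakCouplingRates
open Summit.QuantumFields.YangMills.Theorems.FreeEnergyLogCoefficient
open Summit.QuantumFields.YangMills.Theorems.ColdBoxAllGroups (cfgTE unscaleTE TSpaceD gaussD goodTE tiltWE coldGoodSetG
  measurableSet_ball_unscaleTE measurableSet_goodTE measurable_tiltWE measurable_cfgTE isProbabilityMeasure_gaussD abs_tiltWE_le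
  gaussD_real_compl_goodTE_inter_ball_le)

namespace Summit.QuantumFields.YangMills.Theorems.SoftLoopLongLag

variable {N : ℕ} {G : Type} [Group G] (ρ : G →* Matrix (Fin N) (Fin N) ℂ) {H : ℕ}

/-! ## The loop cost observable: invariance, continuity, bounds -/

/-- A finite sum of gauge-invariant real observables is gauge invariant. -/
theorem isZdGaugeInvariant_sum {ι : Type*} (s : Finset ι) {F : ι → LGConfig 4 G → ℝ} (hF : ∀ i ∈ s, IsZdGaugeInvariant (F i)) :
    IsZdGaugeInvariant fun U : LGConfig 4 G => ∑ i ∈ s, F i U := fun g U =>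
  Finset.sum_congr rfl fun i hi => hF i hi g U

/-- The product of two gauge-invariant real observables is gauge invariant. -/
theorem isZdGaugeInvariant_mul' {F F' : LGConfig 4 G → ℝ} (hF : IsZdGaugeInvariant F) (hF' : IsZdGaugeInvariant F') :
    IsZdGaugeInvariant fun U : LGConfig 4 G => F U * F' U := fun g U => by
  change F (gaugeTransformZd g U) * F' (gaugeTransformZd g U) = F U * F' U
  rw [hF g U, hF' g U]

section Topological

variable [TopologicalSpace G] [IsTopologicalGroup G]

/-- The loop cost is continuous in the configuration (continuous `ρ`). -/
theorem continuous_loopCost (hρ : Continuous ρ) {x : Site 4} (w : (zdGraph 4).Walk x x) :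
    Continuous fun U : LGConfig 4 G => (N : ℝ) - (ρ (walkHolonomy U w)).trace.re :=
  continuous_const.sub (Complex.continuous_re.comp ((hρ.comp (continuous_walkHolonomy w)).matrix_trace))

end Topological

variable [TopologicalSpace G] [IsTopologicalGroup G] [CompactSpace G] [MeasurableSpace G] [BorelSpace G] [SecondCountableTopology G]

set_option maxHeartbeats 800000 in
/-- **The one-scale expansion at fixed `β` for the cube-smeared soft-loop observable (deterministic core), every compact group presented in
`U(N)`.**  See the module docstring for the hypotheses and the constants; the conclusion is
`|Cov_{boxState[|coldGoodSetG]}(f, g) − (D/2)·Σ_{x,y∈C} M_D(x+u, y+v)²| ≤ 3M²(e^{2w}−1) + 6M²p + 2τ(M+K) + √p(2MK + 3K² + K²)`. -/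
theorem abs_loopCov_cond_sub_gauss_le_coreG (hρ : Continuous ρ) (hinj : Function.Injective ρ)
    (hρu : ∀ g, ρ g ∈ Matrix.unitaryGroup (Fin N) ℂ) {β ε m ℓ Rw p : ℝ} (C : Finset (Site 4)) (u v : Site 4) (R : ℕ)
    {g : EuclideanSpace ℝ (Fin (dimE ρ)) → ℝ} (hgm : Measurable g)
    (hβ : 1 ≤ β) (hH : 1 ≤ H) (hm0 : 0 ≤ m) (hm4 : m ≤ 1 / 4) (hℓ : 0 ≤ ℓ)
    (hg : ∀ a, ‖a‖ ≤ m → |Real.log (g a)| ≤ ℓ) (hRw : 0 ≤ Rw) (hRm : 4 * (R : ℝ) * m ≤ 1 / 4)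
    (hmE : Real.sqrt (dimE ρ) * ((12 * (H : ℝ) ^ 2 + 2 * H + 1) * Rw) / Real.sqrt β ≤ 1 / 4)
    (hmEm : Real.sqrt (dimE ρ) * ((12 * (H : ℝ) ^ 2 + 2 * H + 1) * Rw) / Real.sqrt β ≤ m)
    (hwin : (dimE ρ : ℝ) / 2 * Rw ^ 2 / β + 190 * (Real.sqrt (dimE ρ) * ((12 * (H : ℝ) ^ 2 + 2 * H + 1) * Rw) / Real.sqrt β) ^ 3 <
      β ^ (2 * ε - 1))
    (hp : 240 * (dimE ρ) * (2 * (H : ℝ) + 1) ^ 4 * Real.exp (-Rw ^ 2 / 2) ≤ p) (hp1 : p < 1)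
    (hrep : ∀ X : LGConfig 4 G → ℝ, Measurable X → IsZdGaugeInvariant X → (∀ U, 0 ≤ X U) →
      ∫ U, X U ∂((boxState ρ β H)[|coldGoodSetG ρ H β ε]) =
        ∫ t, X (cfgTE ρ H β t) ∂(((gaussD H (dimE ρ))[|(goodTE ρ H β ε ∩ {t | ∀ e, ‖unscaleTE H (dimE ρ) β t e‖ ≤ m})]).tilted
          ((goodTE ρ H β ε ∩ {t | ∀ e, ‖unscaleTE H (dimE ρ) β t e‖ ≤ m}).indicator (tiltWE ρ H g β)))) :
    |((∫ U, (∑ x ∈ C, β * ((N : ℝ) - (ρ (walkHolonomy U (rectWalk (x + u) 1 2 R R))).trace.re)) *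
            (∑ x ∈ C, β * ((N : ℝ) - (ρ (walkHolonomy U (rectWalk (x + v) 1 2 R R))).trace.re))
            ∂((boxState ρ β H)[|coldGoodSetG ρ H β ε])) -
        (∫ U, ∑ x ∈ C, β * ((N : ℝ) - (ρ (walkHolonomy U (rectWalk (x + u) 1 2 R R))).trace.re)
            ∂((boxState ρ β H)[|coldGoodSetG ρ H β ε])) *
          (∫ U, ∑ x ∈ C, β * ((N : ℝ) - (ρ (walkHolonomy U (rectWalk (x + v) 1 2 R R))).trace.re)
            ∂((boxState ρ β H)[|coldGoodSetG ρ H β ε]))) -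
        (dimE ρ : ℝ) / 2 * ∑ x ∈ C, ∑ y ∈ C,
          (∑ p ∈ rectSurface (x + u) R R, ∑ q ∈ rectSurface (y + v) R R,
            boxDirProjKernel H (p.1, p.2.1.1, p.2.1.2) (q.1, q.2.1.1, q.2.1.2)) ^ 2| ≤
      3 * (#C * (β * (4 * R * m) ^ 2 / 2 + 9 * β * (4 * R * m) ^ 3)) ^ 2 *
          (Real.exp (2 * ((#(plaquettesTouching (boxEdges 4 (2 * H + 1))) : ℝ) * (190 * β * m ^ 3) +
            (Fintype.card (ColdFreeIdx H) : ℝ) * ℓ)) - 1) +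
        6 * (#C * (β * (4 * R * m) ^ 2 / 2 + 9 * β * (4 * R * m) ^ 3)) ^ 2 * p +
        2 * (#C * (9 * β * (4 * R * m) ^ 3)) * (#C * (β * (4 * R * m) ^ 2 / 2 + 9 * β * (4 * R * m) ^ 3) + dimE ρ * #C * (R : ℝ) ^ 4) +
        Real.sqrt p * (2 * (#C * (β * (4 * R * m) ^ 2 / 2 + 9 * β * (4 * R * m) ^ 3)) * (dimE ρ * #C * (R : ℝ) ^ 4) +
          3 * (dimE ρ * #C * (R : ℝ) ^ 4) ^ 2 + (dimE ρ * #C * (R : ℝ) ^ 4) ^ 2) := by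
  have hβ0 : 0 < β := by linarith
  -- abbreviations
  set μ := boxState ρ β H with hμ
  set Gd := coldGoodSetG ρ H β ε with hGd
  set γ := gaussD H (dimE ρ) with hγ
  set S : Set (TSpaceD H (dimE ρ)) := goodTE ρ H β ε ∩ {t | ∀ e, ‖unscaleTE H (dimE ρ) β t e‖ ≤ m} with hS
  set cost : Site 4 → LGConfig 4 G → ℝ := fun y U => (N : ℝ) - (ρ (walkHolonomy U (rectWalk y 1 2 R R))).trace.re with hcost
  set f : LGConfig 4 G → ℝ := fun U => ∑ x ∈ C, β * cost (x + u) U with hf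
  set g₂ : LGConfig 4 G → ℝ := fun U => ∑ x ∈ C, β * cost (x + v) U with hg₂
  set F : TSpaceD H (dimE ρ) → ℝ := fun t => f (cfgTE ρ H β t) with hF
  set Gt : TSpaceD H (dimE ρ) → ℝ := fun t => g₂ (cfgTE ρ H β t) with hGt
  set A : Site 4 → Finset (ZdPlaquette 4) := fun x => rectSurface (x + u) R R with hA
  set B : Site 4 → Finset (ZdPlaquette 4) := fun x => rectSurface (x + v) R R with hB
  set Q₁ : TSpaceD H (dimE ρ) → ℝ := fun t =>
    ∑ x ∈ C, 1 / 2 * ∑ i, (∑ p ∈ A x, dirCirc H (p.1, p.2.1.1, p.2.1.2) (t i)) ^ 2 with hQ₁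
  set Q₂ : TSpaceD H (dimE ρ) → ℝ := fun t =>
    ∑ x ∈ C, 1 / 2 * ∑ i, (∑ p ∈ B x, dirCirc H (p.1, p.2.1.1, p.2.1.2) (t i)) ^ 2 with hQ₂
  set tR : ℝ := 4 * R * m with htR
  set M : ℝ := #C * (β * tR ^ 2 / 2 + 9 * β * tR ^ 3) with hM
  set τ : ℝ := #C * (9 * β * tR ^ 3) with hτ
  set K : ℝ := dimE ρ * #C * (R : ℝ) ^ 4 with hK
  set w : ℝ := (#(plaquettesTouching (boxEdges 4 (2 * H + 1))) : ℝ) * (190 * β * m ^ 3) + (Fintype.card (ColdFreeIdx H) : ℝ) * ℓ with hw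
  set ν := (γ[|S]).tilted (S.indicator (tiltWE ρ H g β)) with hν
  have htR0 : 0 ≤ tR := by positivity
  have hM0 : 0 ≤ M := by positivity
  have hτ0 : 0 ≤ τ := by positivity
  have hD0 : (0 : ℝ) ≤ (dimE ρ : ℝ) := Nat.cast_nonneg _
  have hK0 : 0 ≤ K := by positivity
  have hSm : MeasurableSet S := (measurableSet_goodTE ρ hρ hinj β ε).inter (measurableSet_ball_unscaleTE (dimE ρ) β m)
  haveI : IsProbabilityMeasure γ := isProbabilityMeasure_gaussD H (dimE ρ)
  -- the Gaussian mass of the bad event, and `γ S ≠ 0`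
  have hpS : γ.real Sᶜ ≤ p := (gaussD_real_compl_goodTE_inter_ball_le ρ hρ hβ0 hH hRw hmE hmEm hwin).trans hp
  have hS0 : γ S ≠ 0 := by
    intro h0
    have h1 : γ.real S = 0 := by rw [measureReal_def, h0, ENNReal.toReal_zero]
    have h2 : γ.real S + γ.real Sᶜ = 1 := by rw [measureReal_add_measureReal_compl hSm, probReal_univ]
    linarith
  -- measurability, invariance, nonnegativity of the observables
  have hcost_meas : ∀ y, Measurable (cost y) := fun y => (continuous_loopCost ρ hρ (rectWalk y 1 2 R R)).measurable
  have hcost_nn : ∀ y U, 0 ≤ cost y U := fun y U => loopCost_nonneg ρ hρu U (rectWalk y 1 2 R R)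
  have hf_meas : Measurable f := Finset.measurable_sum _ fun x _ => (hcost_meas _).const_mul β
  have hg_meas : Measurable g₂ := Finset.measurable_sum _ fun x _ => (hcost_meas _).const_mul β
  have hf_inv : IsZdGaugeInvariant f :=
    isZdGaugeInvariant_sum C fun x _ => isZdGaugeInvariant_loopCost ρ β (rectWalk (x + u) 1 2 R R)
  have hg_inv : IsZdGaugeInvariant g₂ :=
    isZdGaugeInvariant_sum C fun x _ => isZdGaugeInvariant_loopCost ρ β (rectWalk (x + v) 1 2 R R)
  have hf_nn : ∀ U, 0 ≤ f U := fun U => Finset.sum_nonneg fun x _ => mul_nonneg hβ0.le (hcost_nn _ U)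
  have hg_nn : ∀ U, 0 ≤ g₂ U := fun U => Finset.sum_nonneg fun x _ => mul_nonneg hβ0.le (hcost_nn _ U)
  -- step 1: the representation
  have hrepF : ∫ U, f U ∂(μ[|Gd]) = ∫ t, F t ∂ν := hrep _ hf_meas hf_inv hf_nn
  have hrepG : ∫ U, g₂ U ∂(μ[|Gd]) = ∫ t, Gt t ∂ν := hrep _ hg_meas hg_inv hg_nn
  have hrepFG : ∫ U, f U * g₂ U ∂(μ[|Gd]) = ∫ t, F t * Gt t ∂ν :=
    hrep _ (hf_meas.mul hg_meas) (isZdGaugeInvariant_mul' hf_inv hg_inv) (fun U => mul_nonneg (hf_nn U) (hg_nn U))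
  -- step 2: the bookkeeping inputs
  have hWb : ∀ t, |S.indicator (tiltWE ρ H g β) t| ≤ w := by
    intro t
    by_cases ht : t ∈ S
    · rw [Set.indicator_of_mem ht]
      exact abs_tiltWE_le ρ hρ hβ0 hm0 hm4 hg t ht.2
    · rw [Set.indicator_of_notMem ht, abs_zero, hw]; positivity
  have hcost_ball : ∀ t ∈ S, ∀ y : Site 4, 0 ≤ β * cost y (cfgTE ρ H β t) ∧ β * cost y (cfgTE ρ H β t) ≤ β * tR ^ 2 / 2 + 9 * β * tR ^ 3 ∧
      |β * cost y (cfgTE ρ H β t) - 1 / 2 * ∑ i, (∑ p ∈ rectSurface y R R, dirCirc H (p.1, p.2.1.1, p.2.1.2) (t i)) ^ 2| ≤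
        9 * β * tR ^ 3 := by
    intro t ht y
    refine ⟨mul_nonneg hβ0.le (hcost_nn y _), beta_mul_loopCost_le ρ hρ hβ0 hm0 t ht.2 y R hRm, ?_⟩
    have h := abs_beta_mul_loopCost_sub_loopQ_le ρ hρ hβ0 hm0 t ht.2 y R hRm
    rwa [show (∑ i, (∑ p ∈ rectSurface y R R, dirCirc H (p.1, p.2.1.1, p.2.1.2) (t i)) ^ 2) / 2 =
      1 / 2 * ∑ i, (∑ p ∈ rectSurface y R R, dirCirc H (p.1, p.2.1.1, p.2.1.2) (t i)) ^ 2 by ring] at h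
  have hFb : ∀ t ∈ S, 0 ≤ F t ∧ F t ≤ M := fun t ht => by
    refine ⟨Finset.sum_nonneg fun x _ => (hcost_ball t ht (x + u)).1, ?_⟩
    calc F t = ∑ x ∈ C, β * cost (x + u) (cfgTE ρ H β t) := rfl
      _ ≤ ∑ _x ∈ C, (β * tR ^ 2 / 2 + 9 * β * tR ^ 3) := Finset.sum_le_sum fun x _ => (hcost_ball t ht (x + u)).2.1
      _ = M := by rw [Finset.sum_const, nsmul_eq_mul]
  have hGb : ∀ t ∈ S, 0 ≤ Gt t ∧ Gt t ≤ M := fun t ht => by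
    refine ⟨Finset.sum_nonneg fun x _ => (hcost_ball t ht (x + v)).1, ?_⟩
    calc Gt t = ∑ x ∈ C, β * cost (x + v) (cfgTE ρ H β t) := rfl
      _ ≤ ∑ _x ∈ C, (β * tR ^ 2 / 2 + 9 * β * tR ^ 3) := Finset.sum_le_sum fun x _ => (hcost_ball t ht (x + v)).2.1
      _ = M := by rw [Finset.sum_const, nsmul_eq_mul]
  have hFQ : ∀ t ∈ S, |F t - Q₁ t| ≤ τ := fun t ht => by
    have e : F t - Q₁ t = ∑ x ∈ C, (β * cost (x + u) (cfgTE ρ H β t) -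
        1 / 2 * ∑ i, (∑ p ∈ A x, dirCirc H (p.1, p.2.1.1, p.2.1.2) (t i)) ^ 2) := by
      simp only [hF, hf, hQ₁, Finset.sum_sub_distrib]
    rw [e]
    refine (Finset.abs_sum_le_sum_abs _ _).trans ?_
    calc ∑ x ∈ C, |β * cost (x + u) (cfgTE ρ H β t) - 1 / 2 * ∑ i, (∑ p ∈ A x, dirCirc H (p.1, p.2.1.1, p.2.1.2) (t i)) ^ 2|
        ≤ ∑ _x ∈ C, 9 * β * tR ^ 3 := Finset.sum_le_sum fun x _ => (hcost_ball t ht (x + u)).2.2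
      _ = τ := by rw [Finset.sum_const, nsmul_eq_mul]
  have hGQ : ∀ t ∈ S, |Gt t - Q₂ t| ≤ τ := fun t ht => by
    have e : Gt t - Q₂ t = ∑ x ∈ C, (β * cost (x + v) (cfgTE ρ H β t) -
        1 / 2 * ∑ i, (∑ p ∈ B x, dirCirc H (p.1, p.2.1.1, p.2.1.2) (t i)) ^ 2) := by
      simp only [hGt, hg₂, hQ₂, Finset.sum_sub_distrib]
    rw [e]
    refine (Finset.abs_sum_le_sum_abs _ _).trans ?_
    calc ∑ x ∈ C, |β * cost (x + v) (cfgTE ρ H β t) - 1 / 2 * ∑ i, (∑ p ∈ B x, dirCirc H (p.1, p.2.1.1, p.2.1.2) (t i)) ^ 2|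
        ≤ ∑ _x ∈ C, 9 * β * tR ^ 3 := Finset.sum_le_sum fun x _ => (hcost_ball t ht (x + v)).2.2
      _ = τ := by rw [Finset.sum_const, nsmul_eq_mul]
  -- the Gaussian moments: `#(rectSurface) ≤ R²`
  have hcardA : ∀ x ∈ C, (#(A x) : ℝ) ≤ (R : ℝ) ^ 2 := fun x _ => by
    have h := card_rectSurface_le (x + u) R R
    have : (#(A x) : ℝ) ≤ ((R * R : ℕ) : ℝ) := by exact_mod_cast h
    simpa [sq] using this
  have hcardB : ∀ x ∈ C, (#(B x) : ℝ) ≤ (R : ℝ) ^ 2 := fun x _ => by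
    have h := card_rectSurface_le (x + v) R R
    have : (#(B x) : ℝ) ≤ ((R * R : ℕ) : ℝ) := by exact_mod_cast h
    simpa [sq] using this
  obtain ⟨hQ₁L2, hQ₁K⟩ := memLp_two_loopQ (H := H) (D := dimE ρ) C A (c := 1 / 2) hcardA
  obtain ⟨hQ₂L2, hQ₂K⟩ := memLp_two_loopQ (H := H) (D := dimE ρ) C B (c := 1 / 2) hcardB
  obtain ⟨hQ₁₂L2, hQ₁₂K⟩ := memLp_two_loopQ_mul_loopQ (H := H) (D := dimE ρ) C A B (c := 1 / 2) hcardA hcardB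
  have hKeq : 2 * (1 / 2 : ℝ) * (dimE ρ) * #C * ((R : ℝ) ^ 2) ^ 2 = K := by rw [hK]; ring
  rw [hKeq] at hQ₁K hQ₂K hQ₁₂K
  have hbook := abs_cov_tilted_cond_sub_cov_le (γ := γ) hSm hS0 (measurable_tiltWE ρ hρ hinj hgm β) hWb
    (hf_meas.comp (measurable_cfgTE ρ hρ hinj β)) (hg_meas.comp (measurable_cfgTE ρ hρ hinj β))
    hQ₁L2 hQ₂L2 hQ₁₂L2 hM0 hτ0 hK0 (by positivity : (0 : ℝ) ≤ 3 * K ^ 2) hFb hGb hFQ hGQ hpS hQ₁K hQ₂K hQ₁₂K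
  -- step 3: the colour identity
  have hcol : (∫ t, Q₁ t * Q₂ t ∂γ) - (∫ t, Q₁ t ∂γ) * (∫ t, Q₂ t ∂γ) =
      (dimE ρ : ℝ) / 2 * ∑ x ∈ C, ∑ y ∈ C,
        (∑ p ∈ rectSurface (x + u) R R, ∑ q ∈ rectSurface (y + v) R R,
          boxDirProjKernel H (p.1, p.2.1.1, p.2.1.2) (q.1, q.2.1.1, q.2.1.2)) ^ 2 := by
    have h := cov_loopQ_gaussD_eq (H := H) (D := dimE ρ) C A B (1 / 2)
    simp only [hQ₁, hQ₂, hA, hB, hγ] at h ⊢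
    rw [h]
    ring
  -- assemble
  have hcov : ((∫ U, f U * g₂ U ∂(μ[|Gd])) - (∫ U, f U ∂(μ[|Gd])) * (∫ U, g₂ U ∂(μ[|Gd]))) -
      (dimE ρ : ℝ) / 2 * ∑ x ∈ C, ∑ y ∈ C,
        (∑ p ∈ rectSurface (x + u) R R, ∑ q ∈ rectSurface (y + v) R R,
          boxDirProjKernel H (p.1, p.2.1.1, p.2.1.2) (q.1, q.2.1.1, q.2.1.2)) ^ 2 =
      ((∫ t, F t * Gt t ∂ν) - (∫ t, F t ∂ν) * (∫ t, Gt t ∂ν)) -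
        ((∫ t, Q₁ t * Q₂ t ∂γ) - (∫ t, Q₁ t ∂γ) * (∫ t, Q₂ t ∂γ)) := by
    rw [hcol, hrepF, hrepG, hrepFG]
  rw [hcov]
  exact hbook

end Summit.QuantumFields.YangMills.Theorems.SoftLoopLongLag

end
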